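import Literature.AnabelianGeometry.AbsoluteAnabelian.FundamentalExtension
import HarnessLib

/-!
# [AbsTopII] Ex 3.2 (i): the `[N]`-covering subgroup `Π_U ⊆ Π_D` of a once-punctured elliptic curve,
# described group-theoretically (the ⋏-step "`D ⇝ U`" of the elliptic cuspidalization chain)

S. Mochizuki, *Topics in Absolute Anabelian Geometry II: Decomposition Groups and Endomorphisms*
[AbsTopII] (bib `MochizukiAbsTopII2013`; locators = PDF pages of the kurims manuscript
`paper:url-585b8d0ad0d9`, read on the cell's render p0066/p0068), Example 3.2 (i) p. 66 l. 3–37 and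
Corollary 3.3 (iii)(a) p. 68 l. 36–45.

Statements file (abc-iut cell, row «COR34-DATUM» step (S1) of the design memo STATUS 11:36:54Z, seat
abc-iut-L4-t4 gen 7).  PRINT (Ex 3.2 (i), verbatim on the render): "Let `N` be a positive integer; `D` a
once-punctured elliptic curve over a finite Galois extension `k′` of `k` such that all of the `N`-torsion
points of the underlying elliptic curve `E` of `D` are defined over `k′` [...].  Then the morphism
`[N]_E : E → E` given by multiplication by `N` determines a finite étale covering `[N]_D : U → D` [of
degree `N²`], together with an open embedding `U ↪ D`" and the chain "`D ⇝ U (→ D) ⇝ (U ↪) U_n ⇝ ⋯ ⇝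
(U₂ ↪) U₁ = D` [where `n = N² − 1`] whose associated type-chain is `⋏, •, …, •`"; Cor 3.3 (iii)(a):
"There exists a [not necessarily unique] `Π`-chain, which admits an entirely 'group-theoretic'
description, with associated type-chain `⋏, ⋎, ⋏, •, …, •, ⋏, ⋎`".  The ⋏-step "`D ⇝ U`" is the open
subgroup `Π_U ⊆ Π_D` of the covering `[N]_D`; THIS FILE TYPES ITS GROUP-THEORETIC DESCRIPTION from the
extension `1 → Δ_D → Π_D → G′ → 1` and the cusp of `D` (decomposition group `D_x`, inertia `I_x`):

  `Π_U = (Π_D ↠ Π_E)⁻¹ (N·Δ_E · D_O)`,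

where `Π_D ↠ Π_E := Π_D / K_x` is the de-cuspidalization at the cusp `x` (`K_x` = the closed normal
subgroup topologically normally generated by `I_x`, [AbsTopI] Def 4.2 (iii)(c); `E` = the elliptic
curve), `Δ_E = Δ_D / K_x` (`≅ Ẑ²`, abelian), `N·Δ_E` = the closed subgroup of `N`-th powers, and `D_O` =
the image of `D_x` = the decomposition group of the origin `O ∈ E(k′)` (a section of `Π_E ↠ G′`): the
covering `[N] : E → E` is Galois with group `E[N]`, fixes `O`, and induces multiplication by `N` on
`Δ_E = T(E)`, so its open subgroup is `[N]_* Π_E = N·Δ_E · D_O` (index `N²`), and `U = [N]⁻¹(D)` is its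
pull-back to `Π_D`.  Pulled back to `Π_D` the three generators are `K_x`, the `N`-th powers of `Δ_D`, and
`D_x`:

* `CuspidalData.cuspKernel CD x` — `K_x`, the kernel of the de-cuspidalization of `Π` at the cusp `x`;
* `FundamentalExtension.geomPowSubgroup E N` — the subgroup generated by the `N`-th powers of `Δ`;
* `CuspidalData.torsionCoveringSubgroup CD x N` — `Π_U := closure (K_x ⊔ ⟨Δ^N⟩ ⊔ D_x)`, **the
  `[N]`-covering subgroup** (the ⋏-step of the chain of Ex 3.2 (i) / Cor 3.3 (iii)(a), as a subgroup of
  `Π = Π_D`).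

WHY (design memo, abc-iut-L4-t6's question on Cor 3.4): the typed output predicates of Cor 3.3 (iii)
(`EllipticDatumModel.Matches`, `EllipticCuspidalization.RealizesChain`) leave the ⋏-step an ARBITRARY open
subgroup of `Π_D`; print pins it ("entirely group-theoretic description"), and Cor 3.4 compares the
resulting CANONICAL cuspidalizations — the pin is this subgroup (consumed by the sequel rows (S2)–(S5)).
Generic over any extension `E` with cuspidal data (no once-punctured / elliptic hypothesis is needed to
DEFINE the subgroup; its meaning is the printed one when `Π = Π_D`).  Deliberately NOT here: the
de-cuspidalized quotient `Π_E` as an object, the index computation `[Π_D : Π_U] = N²` (needs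
`Δ_E ≅ Ẑ²` and the rationality of `E[N]` over `k′`), the chain itself.
HONEST FRAMING: real definitions over the tree's `FundamentalExtension` / `CuspidalData`; typed ≠ proved;
nothing here bears on [IUTchIII] Cor 3.12.
-/

noncomputable section

open Topology
open scoped Pointwise

universe u

namespace Literature.AnabelianGeometry.AbsoluteAnabelian

namespace FundamentalExtension

variable (E : FundamentalExtension.{u})

/-- **The `N`-th powers of `Δ`**: the subgroup of `Π` generated by `{δ^N | δ ∈ Δ}` — it maps onto
(a dense subgroup of) `N·Δ_E` under any de-cuspidalization `Π_D ↠ Π_E` with `Δ_E` abelian (Ex 3.2 (i):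
"`[N]_E : E → E` given by multiplication by `N`"). [cite: MochizukiAbsTopII2013, Ex 3.2 (i) p.66] -/
def geomPowSubgroup (N : ℕ) : Subgroup E.arith :=
  Subgroup.closure ((fun δ : E.arith => δ ^ N) '' (E.geom : Set E.arith))

namespace CuspidalData

variable {E} (CD : CuspidalData E)

/-- **`K_x`, the kernel of the de-cuspidalization `Π_D ↠ Π_E` at the cusp `x`**: the closed normal
subgroup of `Π` topologically normally generated by the inertia group `I_x` ([AbsTopI] Def 4.2 (iii)(c),
type •: "`Ker(φ)` is topologically normally generated by a cuspidal decomposition group `C` in `Δⱼ`").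
[cite: MochizukiAbsTopII2013, Ex 3.2 (i) p.66] -/
def cuspKernel (x : CD.Cusp) : Subgroup E.arith :=
  (Subgroup.normalClosure (CD.Icusp x : Set E.arith)).topologicalClosure

/-- **The `[N]`-covering subgroup `Π_U ⊆ Π_D`** of Ex 3.2 (i) (`U = E ∖ E[N] → D = E ∖ O`,
`[N]_D = [N]_E|_U`, degree `N²`), DESCRIBED GROUP-THEORETICALLY from `1 → Δ_D → Π_D → G′ → 1` and the cusp
`x` of `D` (Cor 3.3 (iii)(a): "a `Π`-chain, which admits an entirely 'group-theoretic' description"):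
`Π_U = (Π_D ↠ Π_E)⁻¹(N·Δ_E · D_O)` = the closed subgroup generated by `K_x` (de-cuspidalization kernel),
the `N`-th powers of `Δ_D`, and the decomposition group `D_x` (whose image in `Π_E` is the decomposition
group `D_O` of the origin).  Here for an arbitrary extension `E` (:= `Π_D ↠ G′`) with cuspidal data.
[cite: MochizukiAbsTopII2013, Ex 3.2 (i) p.66] -/
def torsionCoveringSubgroup (x : CD.Cusp) (N : ℕ) : Subgroup E.arith :=
  (CD.cuspKernel x ⊔ E.geomPowSubgroup N ⊔ CD.Dcusp x).topologicalClosure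

end CuspidalData

end FundamentalExtension

end Literature.AnabelianGeometry.AbsoluteAnabelian

end
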